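/-
Copyright: cell `pub-ymgap` (HUMAN RULING D-0062), Track A of `YM-PLAN.md`, DAG node N20 (= NE7b); R134 acceleration seat
`pub-ymgap-dag-n20-c` (strategy s1, generation 3), module 15.  Released under the licence of the surrounding project.
-/
import Summits.QuantumFields.YangMills.Theorems.BalabanUVNodesN20LCSConditionalDominated
import Summits.QuantumFields.YangMills.Theorems.BalabanUVNodesN20LCSAvgExpMoment
import HarnessLib

/-!
# YM-DAG node N20 (= NE7b), strategy s1, module 15: CONDITIONAL (LS) RUNG 1 — local exponential moments of the plaquette energies of the
# ONCE-AVERAGED field `Ū = avgFun expMeanLogSU U` in the small-field-RESTRICTED level-0 state (the all-small history term's own state),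
# uniformly in `β ≥ 4N` and in the volume: the two s1 lineages joined (n20-c's conditional «LCS-0» × n20-d's domination letter)

Track A of `YM-PLAN.md` (cell `pub-ymgap`, HUMAN RULING D-0062), node **N20** = spine estimate NE7b (`T4WeightBudget.RelWeightBound` — the
cell `pub-balaban`'s OWN estimate, NOT PRINTED in [Bałaban 1983–89], NOT PROVED).  Seat `pub-ymgap-dag-n20-c` (R134, s1), module 15
(module 14: `…N20LCSConditionalDominated`, conditional «LCS-0» for dominated carriers; seat `pub-ymgap-dag-n20-d` g3 module 3:
`…N20LCSAvgExpMoment`, the UNCONDITIONAL linear domination letter `sum_one_sub_reTr_plaqHol_avgFun_le` for Bałaban's (0.4) averaging and the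
unconditional (LS) rung 1 `localExpMoment_avgFun`).  Kernel theorems only: 0 `def`, 0 `sorry`, standard axioms; COUNT-NEUTRAL; `--supports`
the K3′ item `SpineGivenEndpointR12` (stmt-QuantumFields-19908) as a helper.  Nothing of Bałaban's is asserted beyond what the two imported
modules read by name (`avgFun`, `expMeanLogSU`, `boxRegion`, `emb`, `deltaSU`).

WHY.  Row NE7b's re-cut road asks «LCS-j» in the HISTORY TERM's own state; at `j = 1` and for the leading (all-small) history this is a
fine-level exponential moment of the pulled-back level-1 carrier `e^{δβ·Σ_{p′∈Q}(1 − Re tr Ū(∂p′))}` against the RESTRICTED density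
`χ_ε·e^{−βA}` (module 1's push-forward `lcs_coarse_iff_fine`).  n20-d's letter dominates the carrier EVERYWHERE by
`e^{aβ·Σ_{q∈X}(1 − Re tr U(∂q))}` on the region `X = ⋃_{p′∈Q} R(p′)` of `≤ M·#Q` level-0 plaquettes, and module 14 bounds the latter's
conditional expectation by `e^{C·a·#X}`.

WHAT IS PROVED ([folklore] assembly): ★★ **`condLocalExpMoment_avgFun`** — for every `N ≥ 1` and `L` there are `δ₀ > 0`, `C ≥ 0`, `c > 0` such
that for every `d = 4` parameter set `P` with `P.L = L`, `1 ≤ m + K`, every `β ≥ 4N`, every threshold with `βε ≥ c`, every `0 ≤ δ ≤ δ₀` and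
every finite set `Q` of level-1 plaquettes, with `M_Q = e^{δβ·Σ_{p′∈Q}(1 − Re tr Ū(∂p′))}` and `χ_ε = ∏_p 𝟙[1 − Re tr U(∂p) ≤ ε]`:
`Integrable (M_Q·χ_ε·e^{−βA}) ∏dU` and `∫ M_Q·χ_ε·e^{−βA} ∏dU ≤ e^{C·δ·#Q} · ∫ χ_ε·e^{−βA} ∏dU` — the CONDITIONAL twin of n20-d's
`localExpMoment_avgFun`, i.e. (LS)₁ in the all-small history term's own state, β-uniform and volume-uniform (constants: `a = δ·A·M ≤ 1∕32`,
`A = 2N(L² + 6(6L)²)² + 2∕α`, `M = (2(7L+2)+1)⁴·16`, `α` from the guard `((6L)²∕4)·√(2Nα) < δ_N`, exactly as in n20-d's module 3).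

HONEST FRAMING.  Level 1, the all-small history only (one threshold on ALL level-0 plaquettes), fine-level (history-term) currency; the
coarse-level reading through module 1's `lcs_coarse_iff_fine` ∕ module 3's `lcs_piece_tstepOfRecord_iff` and the `LocCondStability` binder for
the (A1c) tower are NOT written here (NC-NE7b-α UNRULED); histories with large-field regions and levels `≥ 2` untouched.  NE7b NOT PRINTED ∕
NOT PROVED; (α)-instance 0∕1; N20 NOT discharged; typed 28∕28, discharged count untouched; NOT ℝ⁴, NOT infinite volume, NOT OS axioms,
NOT a mass gap, NOT Clay.
-/

set_option autoImplicit false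

noncomputable section

namespace Summit.QuantumFields.YangMills.BalabanUVNodes.N20LCSConditional

open MeasureTheory Finset
open Literature.MathematicalPhysics.QuantumFieldTheory.Balaban1983to89
open T4Continuum T4ReflectionCone BlockAveraging ExpMeanLog
open Summit.QuantumFields.YangMills.BalabanUVNodes.N20LCSAvgDominationRegion (boxRegion card_boxRegion_le)
open Summit.QuantumFields.YangMills.BalabanUVNodes.N20LCSAvgExpMoment (sum_one_sub_reTr_plaqHol_avgFun_le measurable_exp_plaqSum_avgFun)
open Summit.QuantumFields.YangMills.BalabanUVNodes.N20LCSPushforward (card_biUnion_le_mul)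

variable {N : ℕ} [NeZero N]

/-! ## §8 CONDITIONAL (LS) RUNG 1 -/

/-- **CONDITIONAL (LS) RUNG 1 FOR BAŁABAN's (0.4) AVERAGING OF RECORD, in the all-small history term's own state.**  See the module
docstring for the statement in words; the carrier `e^{δβΣ_{p′∈Q}(1 − Re tr Ū(∂p′))}` of the once-averaged field is integrated against the
small-field-RESTRICTED level-0 density `∏_p 𝟙[1 − Re tr U(∂p) ≤ ε]·e^{−βA(U)}`. [folklore] -/
theorem condLocalExpMoment_avgFun (N : ℕ) [NeZero N] (L : ℕ) :
    ∃ δ₀ : ℝ, 0 < δ₀ ∧ ∃ C c : ℝ, 0 ≤ C ∧ 0 < c ∧ ∀ (P : Params), P.d = 4 → P.L = L → 1 ≤ P.m + P.K →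
      ∀ (β ε δ : ℝ), 4 * N ≤ β → c ≤ β * ε → 0 ≤ δ → δ ≤ δ₀ → ∀ (Q : Finset (Plaq P 1)),
        Integrable (fun U : GaugeField P 0 (Matrix.specialUnitaryGroup (Fin N) ℂ) =>
            (Real.exp (δ * β * ∑ p ∈ Q, (1 - reTr (GaugeField.plaqHol (avgFun (expMeanLogSU (n := Fin N)) U) p))) * ∏ p : Plaq P 0, (if 1 - reTr (GaugeField.plaqHol U p) ≤ ε then (1 : ℝ) else 0)) * Missing.boltzmann P β U) (fieldMeasure P 0 (Matrix.specialUnitaryGroup (Fin N) ℂ)) ∧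
        ∫ U, (Real.exp (δ * β * ∑ p ∈ Q, (1 - reTr (GaugeField.plaqHol (avgFun (expMeanLogSU (n := Fin N)) U) p))) * ∏ p : Plaq P 0, (if 1 - reTr (GaugeField.plaqHol U p) ≤ ε then (1 : ℝ) else 0)) * Missing.boltzmann P β U ∂(fieldMeasure P 0 (Matrix.specialUnitaryGroup (Fin N) ℂ)) ≤
          Real.exp (C * δ * Q.card) * ∫ U, (∏ p : Plaq P 0, (if 1 - reTr (GaugeField.plaqHol U p) ≤ ε then (1 : ℝ) else 0)) * Missing.boltzmann P β U ∂(fieldMeasure P 0 (Matrix.specialUnitaryGroup (Fin N) ℂ)) := by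
  classical
  obtain ⟨C₀, c, hC₀, hc, hdom⟩ := condLCS_dominated N
  -- the constants (functions of `N`, `L` only), as in n20-d's `localExpMoment_avgFun`
  set Nr : ℝ := (Fintype.card (Fin N) : ℝ) with hNr
  set κ : ℝ := ((((4 + 2) * L : ℕ) : ℝ) ^ 2 / 4) with hκ
  set CL : ℝ := (L : ℝ) ^ 2 + 6 * (((4 + 2) * L : ℕ) : ℝ) ^ 2 with hCL
  set α : ℝ := (deltaSU (Fin N) / (2 * (κ + 1))) ^ 2 / (2 * Nr) with hαdef
  set A : ℝ := 2 * Nr * CL ^ 2 + 2 / α with hA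
  set M : ℕ := (2 * ((4 + 3) * L + 2) + 1) ^ 4 * 4 ^ 2 with hM
  have hNr0 : 0 < Nr := by rw [hNr]; exact_mod_cast Fintype.card_pos
  have hκ0 : 0 ≤ κ := by positivity
  have hδN := deltaSU_pos (n := Fin N)
  have hα0 : 0 < α := by positivity
  have hA0 : 0 < A := by positivity
  have hMpos : 0 < M := by positivity
  have hM0 : (0 : ℝ) < (M : ℝ) := by exact_mod_cast hMpos
  have hsqrt : Real.sqrt (2 * Nr * α) = deltaSU (Fin N) / (2 * (κ + 1)) := by
    rw [hαdef, mul_div_cancel₀ _ (by positivity : (2 : ℝ) * Nr ≠ 0)]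
    exact Real.sqrt_sq (by positivity)
  have hguard : κ * Real.sqrt (2 * Nr * α) < deltaSU (Fin N) := by
    rw [hsqrt]
    have h1 : κ / (2 * (κ + 1)) < 1 := by
      rw [div_lt_one (by positivity)]; linarith
    calc κ * (deltaSU (Fin N) / (2 * (κ + 1))) = deltaSU (Fin N) * (κ / (2 * (κ + 1))) := by ring
      _ < deltaSU (Fin N) * 1 := mul_lt_mul_of_pos_left h1 hδN
      _ = deltaSU (Fin N) := mul_one _
  refine ⟨1 / (32 * (A * M)), by positivity, C₀ * A * M * M, c, by positivity, hc, ?_⟩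
  intro P hd hL hmK β ε δ hβ hcε hδ0 hδ1 Q
  have hNpos : (0 : ℝ) < N := Nat.cast_pos.mpr (Nat.pos_of_ne_zero (NeZero.ne N))
  have hβpos : 0 < β := lt_of_lt_of_le (by positivity) hβ
  have hβ0 : 0 ≤ β := hβpos.le
  have hj : 0 + 1 ≤ P.m + P.K := by simpa using hmK
  have hdL1 : ((P.d + 2) * P.L : ℕ) = (4 + 2) * L := by rw [hd, hL]
  have hdL2 : (2 * ((P.d + 3) * P.L + 2) + 1) ^ P.d * P.d ^ 2 = M := by rw [hd, hL]
  have hPL : (P.L : ℝ) = (L : ℝ) := by rw [hL]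
  have hguardP : ((((P.d + 2) * P.L : ℕ) : ℝ) ^ 2 / 4) * Real.sqrt (2 * (Fintype.card (Fin N) : ℝ) * α) <
      deltaSU (Fin N) := by
    rw [hdL1]; exact hguard
  -- the region, the tilt `a = δ·A·M ≤ 1/32`, and `t = aβ`
  set R : Plaq P 1 → Finset (Plaq P 0) := fun p => boxRegion (emb p.src) ((P.d + 3) * P.L + 2) with hR
  set X : Finset (Plaq P 0) := Q.biUnion R with hX
  set a : ℝ := δ * (A * M) with ha
  have ha0 : 0 ≤ a := by positivity
  have ha32 : a ≤ 1 / 32 := by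
    rw [ha]
    calc δ * (A * M) ≤ 1 / (32 * (A * M)) * (A * M) := mul_le_mul_of_nonneg_right hδ1 (by positivity)
      _ = 1 / 32 := by field_simp
  have ht0 : 0 ≤ a * β := mul_nonneg ha0 hβ0
  have ht : a * β ≤ β / 32 := by
    rw [le_div_iff₀ (by norm_num : (0 : ℝ) < 32)]
    nlinarith
  -- pointwise domination EVERYWHERE (n20-d's two-regime letter)
  have hpt : ∀ U : GaugeField P 0 (Matrix.specialUnitaryGroup (Fin N) ℂ),
      δ * β * ∑ p ∈ Q, (1 - reTr (GaugeField.plaqHol (avgFun (expMeanLogSU (n := Fin N)) U) p)) ≤ a * β * ∑ q ∈ X, (1 - reTr (GaugeField.plaqHol U q)) := by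
    intro U
    have h := sum_one_sub_reTr_plaqHol_avgFun_le (n := Fin N) (P := P) (j := 0) hj hα0 hguardP U Q
    rw [hdL1, hdL2, hPL] at h
    have h' : ∑ p ∈ Q, (1 - reTr (GaugeField.plaqHol (avgFun (expMeanLogSU (n := Fin N)) U) p)) ≤ A * M * ∑ q ∈ X, (1 - reTr (GaugeField.plaqHol U q)) := by
      refine h.trans (le_of_eq ?_)
      rw [hA, hCL, hNr, hX, hR]
    have hδβ : 0 ≤ δ * β := mul_nonneg hδ0 hβ0
    calc δ * β * ∑ p ∈ Q, (1 - reTr (GaugeField.plaqHol (avgFun (expMeanLogSU (n := Fin N)) U) p))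
        ≤ δ * β * (A * M * ∑ q ∈ X, (1 - reTr (GaugeField.plaqHol U q))) := mul_le_mul_of_nonneg_left h' hδβ
      _ = a * β * ∑ q ∈ X, (1 - reTr (GaugeField.plaqHol U q)) := by rw [ha]; ring
  -- module 14 on the region `X` with the carrier `e^{δβΣ_Q(…Ū…)}`
  obtain ⟨hint, hle⟩ := hdom P hd β ε (a * β) hβ hcε ht0 ht X
    (fun U => Real.exp (δ * β * ∑ p ∈ Q, (1 - reTr (GaugeField.plaqHol (avgFun (expMeanLogSU (n := Fin N)) U) p))))
    (measurable_exp_plaqSum_avgFun P (δ * β) Q) (fun U => (Real.exp_pos _).le)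
    (fun U _ => Real.exp_le_exp.2 (hpt U))
  refine ⟨hint, hle.trans ?_⟩
  -- the region count `#X ≤ M·#Q` and the constant
  have hXcard : (X.card : ℝ) ≤ (M : ℝ) * Q.card := by
    have h := card_biUnion_le_mul Q R M fun p _ => by
      have := card_boxRegion_le (emb p.src) ((P.d + 3) * P.L + 2)
      rwa [hdL2] at this
    exact_mod_cast h
  have hI0 : 0 ≤ ∫ U, (∏ p : Plaq P 0, (if 1 - reTr (GaugeField.plaqHol U p) ≤ ε then (1 : ℝ) else 0)) * Missing.boltzmann P β U ∂(fieldMeasure P 0 (Matrix.specialUnitaryGroup (Fin N) ℂ)) :=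
    integral_nonneg fun U => mul_nonneg (Finset.prod_nonneg fun p _ => by split_ifs <;> norm_num) (Missing.boltzmann_pos P β U).le
  refine mul_le_mul_of_nonneg_right (Real.exp_le_exp.2 ?_) hI0
  have haβ : a * β / β = a := mul_div_cancel_right₀ a hβpos.ne'
  rw [haβ]
  calc C₀ * a * X.card ≤ C₀ * a * ((M : ℝ) * Q.card) := mul_le_mul_of_nonneg_left hXcard (by positivity)
    _ = C₀ * A * M * M * δ * Q.card := by rw [ha]; ring

end Summit.QuantumFields.YangMills.BalabanUVNodes.N20LCSConditional

end
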